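import Summits.BirchSwinnertonDyer.BirchSwinnertonDyer.Theorems.ManinLocalTwoThreeEtaCuspBasisNinetySix
import Summits.BirchSwinnertonDyer.BirchSwinnertonDyer.Theorems.ManinLocalTwoThreeBasisOneHundredEight
import Summits.BirchSwinnertonDyer.BirchSwinnertonDyer.Theorems.ManinLocalTwoThreeBasisFortyFour
import HarnessLib

/-!
# Level 96: `dim S₂(Γ₀(96)) = 9`, the pivot columns `1,2,3,4,5,6,7,9,11` of the `η`-basis `B1c…B9c`

Cell `bsd-f2-manin`, route `ManinLocalTwoThree`, crux C2 `ManinOddAtFour` (stmt-BirchSwinnertonDyer-22967), prover seat p1 gen 25; `--supports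
stmt-BirchSwinnertonDyer-22967` (helper).  Second file of the level-`96` pinning (after `…EtaCuspBasisNinetySix`): §1 `μ(Γ₀(96)) = 192`, `ν_∞ = 16`,
`ν₂ = ν₃ = 0`, `g(X₀(96)) = 9`, `dim S₂(Γ₀(96)) = 9` (tree `finrank_cuspForm_two_eq_genusX0_holds`); §2 the coefficient functional on combinations
(`cuspCoeff_sum_smul96`) and the pivot columns (an g51 `pinsolve-96.out`: `n = 1, 2, 3, 4, 5, 6, 7, 9, 11`) of the nine forms read off the kernel
tables.  Generator `HOME/p1/g25/gen96.py`.  Nothing here proves C2, Manin's conjecture or BSD.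
[cite: DiamondShurman2005, Thm. 3.1.1, Thm. 3.5.1] [cite: CremonaAlgorithms1997, Table 3 (N = 96)]
-/

set_option autoImplicit false
-- lint-debt: the directory name repeats the summit name (sibling precedent `ManinLocalTwoThreeEtaCuspBasisOneHundredEight.lean`)
set_option linter.dupNamespace false

noncomputable section

open Complex
open UpperHalfPlane hiding I
open scoped MatrixGroups ModularForm
open CongruenceSubgroup PowerSeries
open Literature.NumberTheory.ModularForms
open Literature.NumberTheory.EllipticCurves Literature.NumberTheory.EllipticCurves.ModularForms

namespace Summit.BirchSwinnertonDyer.BirchSwinnertonDyer.Theorems.ManinLocalTwoThree.LevelNinetySix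

/-! ## §1 `dim S₂(Γ₀(96)) = 9` -/

/-- `μ(Γ₀(96)) = 192`, `ν_∞ = 16`, `ν₂ = ν₃ = 0`. [cite: DiamondShurman2005, §3.8] -/
theorem gamma0_data_96 : gamma0Index 96 = 192 ∧ nuInfty 96 = 16 ∧ nu₂ 96 = 0 ∧ nu₃ 96 = 0 :=
  ⟨(gamma0Index_mul (m := 32) (n := 3) (by norm_num)).trans
      (by rw [show (32 : ℕ) = 2 ^ 5 by norm_num, gamma0Index_prime_pow (p := 2) (e := 5) Nat.prime_two (by norm_num),
        gamma0Index_prime Nat.prime_three]; norm_num),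
    by decide, by rw [nu₂_eq_card]; decide, by rw [nu₃_eq_card]; decide⟩

/-- `g(X₀(96)) = 9`. [cite: DiamondShurman2005, Thm. 3.1.1] -/
theorem genusX0_ninetySix : genusX0 96 = 9 := by
  obtain ⟨h1, h2, h3, h4⟩ := gamma0_data_96
  rw [genusX0, h1, h2, h3, h4]

/-- **`dim S₂(Γ₀(96)) = 9`.** [cite: DiamondShurman2005, Thm. 3.5.1] -/
theorem finrank_cuspForm_two_ninetySix : Module.finrank ℂ (CuspForm (Gamma0 96) 2) = 9 := by
  have h := finrank_cuspForm_two_eq_genusX0_holds 96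
  unfold finrank_cuspForm_two_eq_genusX0 at h
  rw [h, genusX0_ninetySix]

/-! ## §2 The nine cusp forms, the coefficient functional, the pivot columns -/

/-- The nine cusp forms `(B1c, …, B9c)`. [folklore] -/
def basis96 : Fin 9 → CuspForm (Gamma0 96) 2 := ![B1c, B2c, B3c, B4c, B5c, B6c, B7c, B8c, B9c]

/-- `q`-coefficients of a finite combination in `S₂(Γ₀(96))`. [folklore] -/
theorem cuspCoeff_sum_smul96 (c : Fin 9 → ℂ) (v : Fin 9 → CuspForm (Gamma0 96) 2) (n : ℕ) :
    cuspCoeff (∑ i, c i • v i) n = ∑ i, c i * cuspCoeff (v i) n := by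
  rw [← cuspCoeffₗ_apply (one_mem_strictPeriods_coe_gamma0 96) n, map_sum]
  refine Finset.sum_congr rfl fun i _ ↦ ?_
  rw [map_smul, smul_eq_mul, cuspCoeffₗ_apply]

/-- The pivot `q`-coefficients of `B1c` (from the kernel table `eB1`). [cite: Koehler2011, §2.1] -/
theorem cols_B1c :
    cuspCoeff B1c 1 = (0 : ℂ) ∧
    cuspCoeff B1c 2 = (0 : ℂ) ∧
    cuspCoeff B1c 3 = (0 : ℂ) ∧
    cuspCoeff B1c 4 = (0 : ℂ) ∧
    cuspCoeff B1c 5 = (0 : ℂ) ∧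
    cuspCoeff B1c 6 = (0 : ℂ) ∧
    cuspCoeff B1c 7 = (1 : ℂ) ∧
    cuspCoeff B1c 9 = (0 : ℂ) ∧
    cuspCoeff B1c 11 = (-1 : ℂ) := by
  refine ⟨?_, ?_, ?_, ?_, ?_, ?_, ?_, ?_, ?_⟩ <;> (rw [cuspCoeff, ← coeff_B1c _ (by norm_num)]; norm_num [eB1])

/-- The pivot `q`-coefficients of `B2c` (from the kernel table `eB2`). [cite: Koehler2011, §2.1] -/
theorem cols_B2c :
    cuspCoeff B2c 1 = (0 : ℂ) ∧
    cuspCoeff B2c 2 = (0 : ℂ) ∧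
    cuspCoeff B2c 3 = (1 : ℂ) ∧
    cuspCoeff B2c 4 = (0 : ℂ) ∧
    cuspCoeff B2c 5 = (0 : ℂ) ∧
    cuspCoeff B2c 6 = (0 : ℂ) ∧
    cuspCoeff B2c 7 = (-2 : ℂ) ∧
    cuspCoeff B2c 9 = (0 : ℂ) ∧
    cuspCoeff B2c 11 = (2 : ℂ) := by
  refine ⟨?_, ?_, ?_, ?_, ?_, ?_, ?_, ?_, ?_⟩ <;> (rw [cuspCoeff, ← coeff_B2c _ (by norm_num)]; norm_num [eB2])

/-- The pivot `q`-coefficients of `B3c` (from the kernel table `eB3`). [cite: Koehler2011, §2.1] -/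
theorem cols_B3c :
    cuspCoeff B3c 1 = (1 : ℂ) ∧
    cuspCoeff B3c 2 = (0 : ℂ) ∧
    cuspCoeff B3c 3 = (0 : ℂ) ∧
    cuspCoeff B3c 4 = (0 : ℂ) ∧
    cuspCoeff B3c 5 = (-1 : ℂ) ∧
    cuspCoeff B3c 6 = (0 : ℂ) ∧
    cuspCoeff B3c 7 = (0 : ℂ) ∧
    cuspCoeff B3c 9 = (0 : ℂ) ∧
    cuspCoeff B3c 11 = (0 : ℂ) := by
  refine ⟨?_, ?_, ?_, ?_, ?_, ?_, ?_, ?_, ?_⟩ <;> (rw [cuspCoeff, ← coeff_B3c _ (by norm_num)]; norm_num [eB3])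

/-- The pivot `q`-coefficients of `B4c` (from the kernel table `eB4`). [cite: Koehler2011, §2.1] -/
theorem cols_B4c :
    cuspCoeff B4c 1 = (0 : ℂ) ∧
    cuspCoeff B4c 2 = (0 : ℂ) ∧
    cuspCoeff B4c 3 = (0 : ℂ) ∧
    cuspCoeff B4c 4 = (0 : ℂ) ∧
    cuspCoeff B4c 5 = (1 : ℂ) ∧
    cuspCoeff B4c 6 = (0 : ℂ) ∧
    cuspCoeff B4c 7 = (0 : ℂ) ∧
    cuspCoeff B4c 9 = (-1 : ℂ) ∧
    cuspCoeff B4c 11 = (0 : ℂ) := by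
  refine ⟨?_, ?_, ?_, ?_, ?_, ?_, ?_, ?_, ?_⟩ <;> (rw [cuspCoeff, ← coeff_B4c _ (by norm_num)]; norm_num [eB4])

/-- The pivot `q`-coefficients of `B5c` (from the kernel table `eB5`). [cite: Koehler2011, §2.1] -/
theorem cols_B5c :
    cuspCoeff B5c 1 = (0 : ℂ) ∧
    cuspCoeff B5c 2 = (0 : ℂ) ∧
    cuspCoeff B5c 3 = (0 : ℂ) ∧
    cuspCoeff B5c 4 = (0 : ℂ) ∧
    cuspCoeff B5c 5 = (1 : ℂ) ∧
    cuspCoeff B5c 6 = (0 : ℂ) ∧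
    cuspCoeff B5c 7 = (-1 : ℂ) ∧
    cuspCoeff B5c 9 = (1 : ℂ) ∧
    cuspCoeff B5c 11 = (1 : ℂ) := by
  refine ⟨?_, ?_, ?_, ?_, ?_, ?_, ?_, ?_, ?_⟩ <;> (rw [cuspCoeff, ← coeff_B5c _ (by norm_num)]; norm_num [eB5])

/-- The pivot `q`-coefficients of `B6c` (from the kernel table `eB6`). [cite: Koehler2011, §2.1] -/
theorem cols_B6c :
    cuspCoeff B6c 1 = (0 : ℂ) ∧
    cuspCoeff B6c 2 = (1 : ℂ) ∧
    cuspCoeff B6c 3 = (0 : ℂ) ∧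
    cuspCoeff B6c 4 = (0 : ℂ) ∧
    cuspCoeff B6c 5 = (0 : ℂ) ∧
    cuspCoeff B6c 6 = (0 : ℂ) ∧
    cuspCoeff B6c 7 = (0 : ℂ) ∧
    cuspCoeff B6c 9 = (0 : ℂ) ∧
    cuspCoeff B6c 11 = (0 : ℂ) := by
  refine ⟨?_, ?_, ?_, ?_, ?_, ?_, ?_, ?_, ?_⟩ <;> (rw [cuspCoeff, ← coeff_B6c _ (by norm_num)]; norm_num [eB6])

/-- The pivot `q`-coefficients of `B7c` (from the kernel table `eB7`). [cite: Koehler2011, §2.1] -/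
theorem cols_B7c :
    cuspCoeff B7c 1 = (0 : ℂ) ∧
    cuspCoeff B7c 2 = (0 : ℂ) ∧
    cuspCoeff B7c 3 = (0 : ℂ) ∧
    cuspCoeff B7c 4 = (1 : ℂ) ∧
    cuspCoeff B7c 5 = (0 : ℂ) ∧
    cuspCoeff B7c 6 = (0 : ℂ) ∧
    cuspCoeff B7c 7 = (0 : ℂ) ∧
    cuspCoeff B7c 9 = (0 : ℂ) ∧
    cuspCoeff B7c 11 = (0 : ℂ) := by
  refine ⟨?_, ?_, ?_, ?_, ?_, ?_, ?_, ?_, ?_⟩ <;> (rw [cuspCoeff, ← coeff_B7c _ (by norm_num)]; norm_num [eB7])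

/-- The pivot `q`-coefficients of `B8c` (from the kernel table `eB8`). [cite: Koehler2011, §2.1] -/
theorem cols_B8c :
    cuspCoeff B8c 1 = (0 : ℂ) ∧
    cuspCoeff B8c 2 = (0 : ℂ) ∧
    cuspCoeff B8c 3 = (0 : ℂ) ∧
    cuspCoeff B8c 4 = (0 : ℂ) ∧
    cuspCoeff B8c 5 = (0 : ℂ) ∧
    cuspCoeff B8c 6 = (1 : ℂ) ∧
    cuspCoeff B8c 7 = (0 : ℂ) ∧
    cuspCoeff B8c 9 = (0 : ℂ) ∧
    cuspCoeff B8c 11 = (0 : ℂ) := by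
  refine ⟨?_, ?_, ?_, ?_, ?_, ?_, ?_, ?_, ?_⟩ <;> (rw [cuspCoeff, ← coeff_B8c _ (by norm_num)]; norm_num [eB8])

/-- The pivot `q`-coefficients of `B9c` (from the kernel table `eB9`). [cite: Koehler2011, §2.1] -/
theorem cols_B9c :
    cuspCoeff B9c 1 = (0 : ℂ) ∧
    cuspCoeff B9c 2 = (0 : ℂ) ∧
    cuspCoeff B9c 3 = (1 : ℂ) ∧
    cuspCoeff B9c 4 = (0 : ℂ) ∧
    cuspCoeff B9c 5 = (0 : ℂ) ∧
    cuspCoeff B9c 6 = (0 : ℂ) ∧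
    cuspCoeff B9c 7 = (1 : ℂ) ∧
    cuspCoeff B9c 9 = (0 : ℂ) ∧
    cuspCoeff B9c 11 = (-3 : ℂ) := by
  refine ⟨?_, ?_, ?_, ?_, ?_, ?_, ?_, ?_, ?_⟩ <;> (rw [cuspCoeff, ← coeff_B9c _ (by norm_num)]; norm_num [eB9])

end Summit.BirchSwinnertonDyer.BirchSwinnertonDyer.Theorems.ManinLocalTwoThree.LevelNinetySix

end
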